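import Literature.NumberTheory.LFunctions.WeilMarkovQuadratic
import Literature.NumberTheory.LFunctions.WeilExplicitContinuous
import HarnessLib

/-!
# THETA kernel certificate, analytic layer D6 (geometric half): the PRIME SIDE of the odd tail's autocorrelation (RH-FREE)

Cell `rh-explicit`, WEIL column, seat handoff-prove-2 gen12; typing lane of `ThetaCertificateSound`
(THETA-KERNEL-BLUEPRINT v1.3 (P_R); THETA-CERT-cc6 §D4/§D6; director I l.7328 (A)(ii)).  Upper clauses of truncated
Weil forms only; nothing here bears on the truth of RH.

ABSTRACT SETTING.  `T : ℝ → ℂ` vanishes beyond a cut `x₁ < 0` and has the exponential envelope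
`‖T u‖ ≤ E·e^{κ(u − x₁)}` for `u ≤ x₁` (`κ > 0`; for the theta tail `E = M√u₁`, `κ = m + ½`,
`WeilColumnThetaTailNorms.norm_tail_le`/`envelope_eq`; for its mollification `x₁ ↦ x₁ + r`, `E ↦ E e^{κr}`).
With `g(u) = T(u) − T(−u)` and `k = g ⋆ g̃` (`weilConv g (weilReflect g)`):

* `norm_weilConv_weilReflect_oddTail_le`: for `t ≥ 0`,
  **`‖k(t)‖ ≤ E²e^{−κt}/κ + E²·max 0 (t + 2x₁)·e^{−κ(t + 2x₁)}`** — THETA-CERT §D6's `2|C_T| + |V_T(−t)|`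
  (`V_T(t) = 0`): the supports of `T` and `T(−·)` are disjoint, the co-moving overlap decays like `e^{−κt}`,
  the counter-moving one lives on a window of length `w = t + 2x₁ = log(n/N)` (`N = e^{−2x₁}`) at height `e^{−κw}`.
  No measurability of `T` is used (`integral_mono_of_nonneg` against explicit exponential majorants).
* `norm_weilPrimeTerm_le_of_oddTail` (checker currency, `κ = m + ½`): for a Weil test function `g` agreeing with
  `T⁻` and supported in `[−a, a]`,
  **`‖weilPrimeTerm k‖ ≤ (2E²/(m+½))·S₁ + 2E²N^{m+½}·S₂`** whenever the finite prime-power sums satisfy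
  `Σ_{n<K} Λ(n)/n^{m+1} ≤ S₁` and `Σ_{n<K} Λ(n)·max 0 (log(n/N))/n^{m+1} ≤ S₂` (all `K`) — the `primesC` and `cross`
  lets of cc-s2-1's `ThetaTier1Check.check` once `E² = M²u₁`, `u₁√N = 1` and the arithmetic layer's bounds
  `S₁ ≤ pLamHi (m+1)`, `S₂ ≤ 1.03883·N^{−m}(1/m² + e^{−m/(m+1)}/(m+1))` (Rosser–Schoenfeld; the sequel file) are inserted.
-/

noncomputable section

set_option linter.dupNamespace false

open Complex Set MeasureTheory Filter
open scoped Real Topology ComplexConjugate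

namespace Summit.RiemannHypothesis.RiemannHypothesis.Theorems.WeilColumn.ThetaPrime

open Literature.NumberTheory.LFunctions

variable {T g : ℝ → ℂ} {E κ x₁ : ℝ}

/-! ## §1 Pointwise bounds for the odd extension `g(u) = T(u) − T(−u)` -/

/-- On the left (`u ≤ x₁ < 0`) only `T(u)` survives: `‖T u − T(−u)‖ ≤ E e^{κ(u−x₁)}`. -/
theorem norm_odd_le_left (hx₁ : x₁ < 0) (hT0 : ∀ u, x₁ < u → T u = 0)
    (hTE : ∀ u, u ≤ x₁ → ‖T u‖ ≤ E * Real.exp (κ * (u - x₁))) {u : ℝ} (hu : u ≤ x₁) :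
    ‖T u - T (-u)‖ ≤ E * Real.exp (κ * (u - x₁)) := by
  rw [hT0 (-u) (by linarith), sub_zero]; exact hTE u hu

/-- In the middle (`x₁ < u < −x₁`) both vanish. -/
theorem odd_eq_zero_mid (hT0 : ∀ u, x₁ < u → T u = 0) {u : ℝ} (hu : x₁ < u) (hu' : u < -x₁) :
    T u - T (-u) = 0 := by
  rw [hT0 u hu, hT0 (-u) (by linarith), sub_zero]

/-- On the right (`−x₁ ≤ u`, `x₁ < 0`) only `T(−u)` survives: `‖T u − T(−u)‖ ≤ E e^{κ(−u−x₁)}`. -/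
theorem norm_odd_le_right (hx₁ : x₁ < 0) (hT0 : ∀ u, x₁ < u → T u = 0)
    (hTE : ∀ u, u ≤ x₁ → ‖T u‖ ≤ E * Real.exp (κ * (u - x₁))) {u : ℝ} (hu : -x₁ ≤ u) :
    ‖T u - T (-u)‖ ≤ E * Real.exp (κ * (-u - x₁)) := by
  rw [hT0 u (by linarith), zero_sub, norm_neg]; exact hTE (-u) (by linarith)

/-! ## §2 The autocorrelation `k = g ⋆ g̃` of the odd tail: `‖k(t)‖ ≤ E²e^{−κt}/κ + E²·w₊·e^{−κw}` -/

/-- **The kernel bound** (THETA-CERT-cc6 §D6: `|k_T(t)| ≤ 2|C_T(t)| + |V_T(−t)|`, `V_T(t) = 0`): for `x₁ < 0`, `κ > 0`,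
`E ≥ 0`, a function `T` vanishing beyond `x₁` with `‖T u‖ ≤ Ee^{κ(u−x₁)}` (`u ≤ x₁`), any `g` with `g(u) = T(u) − T(−u)`,
and `t ≥ 0`: `‖(g ⋆ g̃)(t)‖ ≤ E²e^{−κt}/κ + E²·max 0 (t + 2x₁)·e^{−κ(t+2x₁)}`. [THETA-CERT-cc6 §D6] -/
theorem norm_weilConv_weilReflect_oddTail_le (hx₁ : x₁ < 0) (hκ : 0 < κ) (hE : 0 ≤ E)
    (hT0 : ∀ u, x₁ < u → T u = 0) (hTE : ∀ u, u ≤ x₁ → ‖T u‖ ≤ E * Real.exp (κ * (u - x₁)))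
    (hg : ∀ u, g u = T u - T (-u)) {t : ℝ} (ht : 0 ≤ t) :
    ‖weilConv g (weilReflect g) t‖ ≤
      E ^ 2 * Real.exp (-κ * t) / κ + E ^ 2 * max 0 (t + 2 * x₁) * Real.exp (-κ * (t + 2 * x₁)) := by
  -- the three majorants
  set m₁ : ℝ → ℝ := (Iic x₁).indicator fun u ↦ E ^ 2 * Real.exp (-κ * t) * Real.exp (2 * κ * (u - x₁)) with hm₁
  set m₂ : ℝ → ℝ := (Ici (t - x₁)).indicator fun u ↦ E ^ 2 * Real.exp (κ * (t - 2 * x₁)) * Real.exp (-(2 * κ) * u)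
    with hm₂
  set m₄ : ℝ → ℝ := (Icc (-x₁) (t + x₁)).indicator fun _ ↦ E ^ 2 * Real.exp (-κ * (t + 2 * x₁)) with hm₄
  have hm₁0 : ∀ u, 0 ≤ m₁ u := fun u ↦ by rw [hm₁]; exact indicator_nonneg (fun _ _ ↦ by positivity) u
  have hm₂0 : ∀ u, 0 ≤ m₂ u := fun u ↦ by rw [hm₂]; exact indicator_nonneg (fun _ _ ↦ by positivity) u
  have hm₄0 : ∀ u, 0 ≤ m₄ u := fun u ↦ by rw [hm₄]; exact indicator_nonneg (fun _ _ ↦ by positivity) u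
  -- integrability and the three integrals
  have hi₁ : Integrable m₁ := by
    rw [hm₁]
    refine IntegrableOn.integrable_indicator ?_ measurableSet_Iic
    have : (fun u : ℝ ↦ E ^ 2 * Real.exp (-κ * t) * Real.exp (2 * κ * (u - x₁))) =
        fun u : ℝ ↦ (E ^ 2 * Real.exp (-κ * t) * Real.exp (-(2 * κ * x₁))) * Real.exp ((2 * κ) * u) := by
      funext u; rw [mul_sub, sub_eq_add_neg, Real.exp_add]; ring
    rw [this]
    exact (integrableOn_exp_mul_Iic (by positivity) x₁).const_mul _
  have hv₁ : ∫ u, m₁ u = E ^ 2 * Real.exp (-κ * t) / (2 * κ) := by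
    rw [hm₁, integral_indicator measurableSet_Iic]
    have : (fun u : ℝ ↦ E ^ 2 * Real.exp (-κ * t) * Real.exp (2 * κ * (u - x₁))) =
        fun u : ℝ ↦ (E ^ 2 * Real.exp (-κ * t) * Real.exp (-(2 * κ * x₁))) * Real.exp ((2 * κ) * u) := by
      funext u; rw [mul_sub, sub_eq_add_neg, Real.exp_add]; ring
    rw [this, integral_const_mul, integral_exp_mul_Iic (by positivity) x₁]
    have e : Real.exp (-(2 * κ * x₁)) * Real.exp (2 * κ * x₁) = 1 := by
      rw [← Real.exp_add, neg_add_cancel, Real.exp_zero]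
    rw [mul_div_assoc', mul_assoc, e, mul_one]
  have hi₂ : Integrable m₂ := by
    rw [hm₂]
    refine IntegrableOn.integrable_indicator ?_ measurableSet_Ici
    rw [integrableOn_Ici_iff_integrableOn_Ioi]
    exact (exp_neg_integrableOn_Ioi (t - x₁) (by positivity : 0 < 2 * κ)).const_mul _
  have hv₂ : ∫ u, m₂ u = E ^ 2 * Real.exp (-κ * t) / (2 * κ) := by
    rw [hm₂, integral_indicator measurableSet_Ici, integral_Ici_eq_integral_Ioi, integral_const_mul,
      integral_exp_mul_Ioi (by linarith) (t - x₁), neg_div_neg_eq]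
    have e : Real.exp (κ * (t - 2 * x₁)) * Real.exp (-(2 * κ) * (t - x₁)) = Real.exp (-κ * t) := by
      rw [← Real.exp_add]; congr 1; ring
    rw [mul_div_assoc', mul_assoc, e]
  have hi₄ : Integrable m₄ := by
    rw [hm₄]
    exact (integrableOn_const (by simp [Real.volume_Icc])).integrable_indicator measurableSet_Icc
  have hv₄ : ∫ u, m₄ u = E ^ 2 * max 0 (t + 2 * x₁) * Real.exp (-κ * (t + 2 * x₁)) := by
    rw [hm₄, integral_indicator_const _ measurableSet_Icc, Real.volume_real_Icc, smul_eq_mul]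
    rw [show t + x₁ - -x₁ = t + 2 * x₁ by ring, max_comm]
    ring
  -- pointwise: `‖g u‖‖g(u−t)‖ ≤ m₁ u + m₂ u + m₄ u`
  have hpt : ∀ u : ℝ, ‖g u‖ * ‖g (u - t)‖ ≤ m₁ u + m₂ u + m₄ u := by
    intro u
    rw [hg u, hg (u - t), show -(u - t) = t - u by ring]
    by_cases hu : u ≤ x₁
    · -- left: T(u)·T(u−t)
      have h1 := norm_odd_le_left hx₁ hT0 hTE hu
      have h2 : ‖T (u - t) - T (t - u)‖ ≤ E * Real.exp (κ * (u - t - x₁)) := by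
        have := norm_odd_le_left hx₁ hT0 hTE (show u - t ≤ x₁ by linarith)
        rwa [show -(u - t) = t - u by ring] at this
      have hval : m₁ u = E ^ 2 * Real.exp (-κ * t) * Real.exp (2 * κ * (u - x₁)) := by
        rw [hm₁, indicator_of_mem (show u ∈ Iic x₁ from hu)]
      have hprod : E * Real.exp (κ * (u - x₁)) * (E * Real.exp (κ * (u - t - x₁))) =
          E ^ 2 * Real.exp (-κ * t) * Real.exp (2 * κ * (u - x₁)) := by
        have e : Real.exp (κ * (u - x₁)) * Real.exp (κ * (u - t - x₁)) =
            Real.exp (-κ * t) * Real.exp (2 * κ * (u - x₁)) := by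
          rw [← Real.exp_add, ← Real.exp_add]; congr 1; ring
        linear_combination (E ^ 2) * e
      calc ‖T u - T (-u)‖ * ‖T (u - t) - T (t - u)‖
          ≤ E * Real.exp (κ * (u - x₁)) * (E * Real.exp (κ * (u - t - x₁))) :=
            mul_le_mul h1 h2 (norm_nonneg _) (by positivity)
        _ = m₁ u := by rw [hprod, hval]
        _ ≤ m₁ u + m₂ u + m₄ u := by linarith [hm₂0 u, hm₄0 u]
    · have hu' : x₁ < u := lt_of_not_ge hu
      by_cases hu2 : u < -x₁
      · rw [odd_eq_zero_mid hT0 hu' hu2, norm_zero, zero_mul]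
        linarith [hm₁0 u, hm₂0 u, hm₄0 u]
      · have hu2' : -x₁ ≤ u := le_of_not_gt hu2
        have h1 := norm_odd_le_right hx₁ hT0 hTE hu2'
        by_cases hα : u ≤ t + x₁
        · -- (α): T(−u)·T(u−t), constant height on `[−x₁, t + x₁]`
          have h2 : ‖T (u - t) - T (t - u)‖ ≤ E * Real.exp (κ * (u - t - x₁)) := by
            have := norm_odd_le_left hx₁ hT0 hTE (show u - t ≤ x₁ by linarith)
            rwa [show -(u - t) = t - u by ring] at this
          have hval : m₄ u = E ^ 2 * Real.exp (-κ * (t + 2 * x₁)) := by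
            rw [hm₄, indicator_of_mem (show u ∈ Icc (-x₁) (t + x₁) from ⟨hu2', hα⟩)]
          have hprod : E * Real.exp (κ * (-u - x₁)) * (E * Real.exp (κ * (u - t - x₁))) =
              E ^ 2 * Real.exp (-κ * (t + 2 * x₁)) := by
            have e : Real.exp (κ * (-u - x₁)) * Real.exp (κ * (u - t - x₁)) = Real.exp (-κ * (t + 2 * x₁)) := by
              rw [← Real.exp_add]; congr 1; ring
            linear_combination (E ^ 2) * e
          calc ‖T u - T (-u)‖ * ‖T (u - t) - T (t - u)‖
              ≤ E * Real.exp (κ * (-u - x₁)) * (E * Real.exp (κ * (u - t - x₁))) :=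
                mul_le_mul h1 h2 (norm_nonneg _) (by positivity)
            _ = m₄ u := by rw [hprod, hval]
            _ ≤ m₁ u + m₂ u + m₄ u := by linarith [hm₁0 u, hm₂0 u]
        · have hα' : t + x₁ < u := lt_of_not_ge hα
          by_cases hγ : t - x₁ ≤ u
          · -- (γ): T(−u)·T(t−u)
            have h2 : ‖T (u - t) - T (t - u)‖ ≤ E * Real.exp (κ * (t - u - x₁)) := by
              have := norm_odd_le_right hx₁ hT0 hTE (show -x₁ ≤ u - t by linarith)
              rwa [show -(u - t) = t - u by ring] at this
            have hval : m₂ u = E ^ 2 * Real.exp (κ * (t - 2 * x₁)) * Real.exp (-(2 * κ) * u) := by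
              rw [hm₂, indicator_of_mem (show u ∈ Ici (t - x₁) from hγ)]
            have hprod : E * Real.exp (κ * (-u - x₁)) * (E * Real.exp (κ * (t - u - x₁))) =
                E ^ 2 * Real.exp (κ * (t - 2 * x₁)) * Real.exp (-(2 * κ) * u) := by
              have e : Real.exp (κ * (-u - x₁)) * Real.exp (κ * (t - u - x₁)) =
                  Real.exp (κ * (t - 2 * x₁)) * Real.exp (-(2 * κ) * u) := by
                rw [← Real.exp_add, ← Real.exp_add]; congr 1; ring
              linear_combination (E ^ 2) * e
            calc ‖T u - T (-u)‖ * ‖T (u - t) - T (t - u)‖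
                ≤ E * Real.exp (κ * (-u - x₁)) * (E * Real.exp (κ * (t - u - x₁))) :=
                  mul_le_mul h1 h2 (norm_nonneg _) (by positivity)
              _ = m₂ u := by rw [hprod, hval]
              _ ≤ m₁ u + m₂ u + m₄ u := by linarith [hm₁0 u, hm₄0 u]
          · -- (β): both factors of `g(u − t)` vanish
            have hz : T (u - t) - T (t - u) = 0 := by
              rw [hT0 (u - t) (by linarith), hT0 (t - u) (by linarith [lt_of_not_ge hγ]), sub_zero]
            rw [hz, norm_zero, mul_zero]
            linarith [hm₁0 u, hm₂0 u, hm₄0 u]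
  -- integrate
  have hk : ‖weilConv g (weilReflect g) t‖ ≤ ∫ u, ‖g u‖ * ‖g (u - t)‖ := by
    rw [weilConv_apply]
    refine (norm_integral_le_integral_norm _).trans (le_of_eq ?_)
    congr 1 with u
    rw [norm_mul, weilReflect, Complex.norm_conj, show -(t - u) = u - t by ring]
  have hmono : ∫ u, ‖g u‖ * ‖g (u - t)‖ ≤ ∫ u, (m₁ u + m₂ u + m₄ u) :=
    integral_mono_of_nonneg (Eventually.of_forall fun u ↦ by positivity) ((hi₁.add hi₂).add hi₄)
      (Eventually.of_forall hpt)
  have hi12 : Integrable (fun u ↦ m₁ u + m₂ u) := hi₁.add hi₂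
  have hsum : ∫ u, (m₁ u + m₂ u + m₄ u) =
      E ^ 2 * Real.exp (-κ * t) / κ + E ^ 2 * max 0 (t + 2 * x₁) * Real.exp (-κ * (t + 2 * x₁)) := by
    rw [integral_add hi12 hi₄, integral_add hi₁ hi₂, hv₁, hv₂, hv₄]
    have hκ0' : κ ≠ 0 := hκ.ne'
    field_simp
    ring
  exact hk.trans (hmono.trans hsum.le)

/-! ## §3 The prime term of the explicit formula at `k = g ⋆ g̃` -/

/-- `‖k(t) + k(−t)‖ ≤ 2‖k(t)‖` for `k = g ⋆ g̃` (`k(−t) = conj k(t)`). [folklore] -/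
theorem norm_weilConv_weilReflect_add_neg_le (g : ℝ → ℂ) (t : ℝ) :
    ‖weilConv g (weilReflect g) t + weilConv g (weilReflect g) (-t)‖ ≤ 2 * ‖weilConv g (weilReflect g) t‖ := by
  rw [weilConv_weilReflect_neg]
  refine (norm_add_le _ _).trans (le_of_eq ?_)
  rw [Complex.norm_conj]; ring

/-- The exponential weights at `t = log n`: for `n ≥ 1` and `κ = m + ½`,
`n^{−½}·e^{−κ log n} = 1/n^{m+1}` and `n^{−½}·e^{−κ(log n + 2x₁)} = N^{m+½}/n^{m+1}` with `N = e^{−2x₁}`. [folklore] -/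
theorem weights_at_log {m : ℕ} {n : ℕ} (hn : 1 ≤ n) (x₁ : ℝ) :
    (1 / Real.sqrt n) * Real.exp (-((m : ℝ) + 1 / 2) * Real.log n) = 1 / (n : ℝ) ^ (m + 1) ∧
    (1 / Real.sqrt n) * Real.exp (-((m : ℝ) + 1 / 2) * (Real.log n + 2 * x₁)) =
      Real.exp (-2 * x₁) ^ m * Real.sqrt (Real.exp (-2 * x₁)) / (n : ℝ) ^ (m + 1) := by
  have hn0 : (0 : ℝ) < n := by exact_mod_cast hn
  have hsq : Real.sqrt n = Real.exp (Real.log n / 2) := by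
    rw [Real.sqrt_eq_rpow, Real.rpow_def_of_pos hn0]; ring_nf
  have hpow : (n : ℝ) ^ (m + 1) = Real.exp (((m : ℝ) + 1) * Real.log n) := by
    rw [← Real.exp_log (pow_pos hn0 (m + 1)), Real.log_pow]; push_cast; ring_nf
  have hsqN : Real.sqrt (Real.exp (-2 * x₁)) = Real.exp (-x₁) := by
    rw [Real.sqrt_eq_rpow, ← Real.exp_mul]; ring_nf
  have hNm : Real.exp (-2 * x₁) ^ m = Real.exp (-(2 * (m : ℝ) * x₁)) := by
    rw [← Real.exp_nat_mul]; ring_nf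
  have e1 : 1 / Real.sqrt n = Real.exp (-(Real.log n / 2)) := by rw [hsq, Real.exp_neg, one_div]
  have e2 : 1 / (n : ℝ) ^ (m + 1) = Real.exp (-(((m : ℝ) + 1) * Real.log n)) := by
    rw [hpow, Real.exp_neg, one_div]
  constructor
  · rw [e1, e2, ← Real.exp_add]; congr 1; ring
  · rw [e1, div_eq_mul_one_div _ ((n : ℝ) ^ (m + 1)), e2, hsqN, hNm, ← Real.exp_add, ← Real.exp_add,
      ← Real.exp_add]
    congr 1; ring

/-- **D6, the prime side in the checker's currency.**  Let `x₁ < 0`, `m ≥ 1`, `E ≥ 0`, `T` vanish beyond `x₁` with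
`‖T u‖ ≤ E e^{(m+½)(u−x₁)}` for `u ≤ x₁`; let `g` be a Weil test function supported in `[−a, a]` with
`g(u) = T(u) − T(−u)`; put `N = e^{−2x₁}`.  If the finite prime-power sums obey `Σ_{n<K} Λ(n)/n^{m+1} ≤ S₁` and
`Σ_{n<K} Λ(n)·max 0 (log n − log N)/n^{m+1} ≤ S₂` for every `K`, then
`‖weilPrimeTerm (g ⋆ g̃)‖ ≤ (2E²/(m+½))·S₁ + 2E²·N^m·√N·S₂`.
(With `E² = M²u₁`, `u₁√N = 1`: `= (4M²u₁/(2m+1))·S₁ + 2M²N^m·S₂` — the `primesC`/`cross` lets.) [THETA-CERT-cc6 §D6] -/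
theorem norm_weilPrimeTerm_le_of_oddTail {m : ℕ} (hm : 1 ≤ m) (hx₁ : x₁ < 0) (hE : 0 ≤ E)
    (hT0 : ∀ u, x₁ < u → T u = 0)
    (hTE : ∀ u, u ≤ x₁ → ‖T u‖ ≤ E * Real.exp (((m : ℝ) + 1 / 2) * (u - x₁)))
    (hgt : IsWeilTest g) {a : ℝ} (hsupp : tsupport g ⊆ Icc (-a) a) (hg : ∀ u, g u = T u - T (-u))
    {S₁ S₂ : ℝ}
    (hS₁ : ∀ K : ℕ, ∑ n ∈ Finset.range K, (ArithmeticFunction.vonMangoldt n : ℝ) / (n : ℝ) ^ (m + 1) ≤ S₁)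
    (hS₂ : ∀ K : ℕ, ∑ n ∈ Finset.range K, (ArithmeticFunction.vonMangoldt n : ℝ) *
      max 0 (Real.log n - Real.log (Real.exp (-2 * x₁))) / (n : ℝ) ^ (m + 1) ≤ S₂) :
    ‖weilPrimeTerm (weilConv g (weilReflect g))‖ ≤
      2 * E ^ 2 / ((m : ℝ) + 1 / 2) * S₁ +
        2 * E ^ 2 * (Real.exp (-2 * x₁) ^ m * Real.sqrt (Real.exp (-2 * x₁))) * S₂ := by
  set k : ℝ → ℂ := weilConv g (weilReflect g) with hk
  set κ : ℝ := (m : ℝ) + 1 / 2 with hκ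
  have hκ0 : 0 < κ := by rw [hκ]; positivity
  -- the kernel vanishes beyond `2a`, so the prime sum is finite
  have hkz : ∀ u : ℝ, 2 * a < |u| → k u = 0 := fun u hu ↦
    weilConv_weilReflect_eq_zero_of_le_abs hgt hsupp hu.le
  rw [WeilContinuous.weilPrimeTerm_eq_sum_of_support hkz]
  set K : ℕ := ⌈Real.exp (2 * a + 1)⌉₊ with hK
  -- termwise bound
  have hterm : ∀ n ∈ Finset.range K,
      ‖((ArithmeticFunction.vonMangoldt n : ℝ) : ℂ) / (Real.sqrt n : ℂ) * (k (Real.log n) + k (-Real.log n))‖ ≤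
        2 * E ^ 2 / κ * ((ArithmeticFunction.vonMangoldt n : ℝ) / (n : ℝ) ^ (m + 1)) +
          2 * E ^ 2 * (Real.exp (-2 * x₁) ^ m * Real.sqrt (Real.exp (-2 * x₁))) *
            ((ArithmeticFunction.vonMangoldt n : ℝ) * max 0 (Real.log n - Real.log (Real.exp (-2 * x₁))) /
              (n : ℝ) ^ (m + 1)) := by
    intro n _
    rcases Nat.eq_zero_or_pos n with h0 | hn
    · subst h0; simp
    have hn1 : 1 ≤ n := hn
    have hΛ : 0 ≤ (ArithmeticFunction.vonMangoldt n : ℝ) := ArithmeticFunction.vonMangoldt_nonneg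
    have hlog : 0 ≤ Real.log n := Real.log_natCast_nonneg n
    have hkb := norm_weilConv_weilReflect_oddTail_le hx₁ hκ0 hE hT0 (by simpa [hκ] using hTE) hg hlog
    have h2 := norm_weilConv_weilReflect_add_neg_le g (Real.log n)
    have hw := weights_at_log (m := m) hn1 x₁
    rw [norm_mul, norm_div, Complex.norm_real, Complex.norm_real, Real.norm_of_nonneg hΛ,
      Real.norm_of_nonneg (Real.sqrt_nonneg _)]
    have hsq0 : 0 < Real.sqrt n := Real.sqrt_pos.2 (by exact_mod_cast hn)
    -- combine
    have hmax : max 0 (Real.log n + 2 * x₁) = max 0 (Real.log n - Real.log (Real.exp (-2 * x₁))) := by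
      rw [Real.log_exp]; ring_nf
    calc (ArithmeticFunction.vonMangoldt n : ℝ) / Real.sqrt n * ‖k (Real.log n) + k (-Real.log n)‖
        ≤ (ArithmeticFunction.vonMangoldt n : ℝ) / Real.sqrt n * (2 * (E ^ 2 * Real.exp (-κ * Real.log n) / κ +
            E ^ 2 * max 0 (Real.log n + 2 * x₁) * Real.exp (-κ * (Real.log n + 2 * x₁)))) :=
          mul_le_mul_of_nonneg_left (h2.trans (by linarith [hkb])) (div_nonneg hΛ hsq0.le)
      _ = 2 * E ^ 2 / κ * ((ArithmeticFunction.vonMangoldt n : ℝ) *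
              ((1 / Real.sqrt n) * Real.exp (-κ * Real.log n))) +
            2 * E ^ 2 * ((ArithmeticFunction.vonMangoldt n : ℝ) * max 0 (Real.log n + 2 * x₁) *
              ((1 / Real.sqrt n) * Real.exp (-κ * (Real.log n + 2 * x₁)))) := by
          field_simp
      _ = _ := by
          rw [hκ, hw.1, hw.2, hmax]
          ring
  refine (norm_sum_le _ _).trans ((Finset.sum_le_sum hterm).trans ?_)
  rw [Finset.sum_add_distrib, ← Finset.mul_sum, ← Finset.mul_sum]
  have hE2 : 0 ≤ 2 * E ^ 2 / κ := by positivity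
  have hE3 : 0 ≤ 2 * E ^ 2 * (Real.exp (-2 * x₁) ^ m * Real.sqrt (Real.exp (-2 * x₁))) := by positivity
  exact add_le_add (mul_le_mul_of_nonneg_left (hS₁ K) hE2) (mul_le_mul_of_nonneg_left (hS₂ K) hE3)

end Summit.RiemannHypothesis.RiemannHypothesis.Theorems.WeilColumn.ThetaPrime

end
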